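import Literature.AlgebraicGeometry.Resolution.OriginLocalRing
import Literature.AlgebraicGeometry.Resolution.QuadraticTransforms
import Literature.AlgebraicGeometry.Resolution.QuadraticTransformsUFD
import Literature.RingTheory.KrullDimension.AffineDimension
import Mathlib.Algebra.MvPolynomial.PDeriv
import Mathlib.Algebra.CharP.Lemmas
import Mathlib.Algebra.CharP.Algebra
import Mathlib.Algebra.GCDMonoid.Basic
import Mathlib.RingTheory.IntegralClosure.IntegrallyClosed
import Mathlib.RingTheory.IntegralClosure.IsIntegralClosure.Basic
import Mathlib.RingTheory.UniqueFactorizationDomain.GCDMonoid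
import Mathlib.RingTheory.Localization.FractionRing
import Mathlib.FieldTheory.IntermediateField.Adjoin.Basic
import HarnessLib

/-!
# Radicial covers of a smooth surface germ: the normalisation of `F[x,y]_{(x,y)}` in
`F(x,y)(z)`, `zᵖ = xᵃyᵇ`, is not regular when `p ∤ a` and `p ∤ b`

Topic: `Literature/Barriers/ResolutionOfSingularities`. Support file (everything PROVED, no
named facts, no definitions) for the barrier catalogue entry
`BaseOnlyRadicialNormalizationCannot.lean` (base-only blow-ups plus normalisation never make
a height-one radicial cover of a smooth surface regular along a suitable valuation).

## The theorem (`not_isRegularLocalRing_integralClosure`, `not_isRegularLocalRing_locAtCentre`)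

Let `F` be a field of characteristic `p > 0`, `L ⊇ F` a field, `x, y ∈ L` algebraically
independent over `F`, `A = F[x,y]_{(x,y)} ⊆ K = F(x,y) ⊆ L` (the tree's `originLocalRing`),
and `z ∈ L` with `zᵖ = xᵃyᵇ`, `p ∤ a`, `p ∤ b`, `L = K(z)`. Then the integral closure `B` of
`A` in `L` is NOT a regular local ring; and for every valuation ring `V` of `L` dominating `A`
the localisation `B_{𝔪_V ∩ B}` equals `B` (so it is not regular either).

This is the local algebra behind the classical toric statement "the affine toric surface of a
cone `σ` is smooth iff `σ` is regular" (Fulton, *Introduction to Toric Varieties*, §2.1–2.2)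
for the index-`p` overlattice `M + ℤ·(a,b)/p` of the first quadrant: `B` is the semigroup
ring of `σ^∨ ∩ (M + ℤ(a,b)/p)` localised at its vertex, regular iff exactly one of `a, b` is
`≡ 0 (mod p)`. The proof given here is elementary and derivation-theoretic instead:

* `A` is a two-dimensional regular local ring, hence factorial (tree:
  `uniqueFactorizationMonoid_of_ringKrullDim_eq_two`), hence integrally closed in `K`; as
  `Lᵖ ⊆ K`, `B ∩ K = A` and `wᵖ ∈ A` for `w ∈ B` (`mem_origin_of_isIntegral_of_mem_adjoin`,
  `pow_char_mem_origin`); `dim B = dim A = 2` (integral extension).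
* If `B` were regular it would be factorial; a common prime factor `π` of `x, y` in `B` would
  generate a prime `(π)` lying over `𝔪_A`, hence maximal, i.e. `𝔪_B = (π)` principal —
  impossible in dimension two. So `xᵃ, yᵇ` are relatively prime in `B`, and `zᵖ = xᵃyᵇ` gives
  `xᵃ = ε·dᵖ` (`ε ∈ B^×`); with `aa' = pc + 1` this yields `x = u·wᵖ`, `u = ε^{a'} ∈ B^× ∩ K = A^×`,
  `w = d^{a'}/x^c ∈ L`.
* Writing `u = U(x,y)/V(x,y)` (`U(0), V(0) ≠ 0`), expanding `w` in powers of `z` over `K` and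
  clearing denominators gives a polynomial identity `X₀·V·Qᵖ = U·Σᵢ Rᵢᵖ (X₀ᵃX₁ᵇ)ⁱ` in
  `F[X₀, X₁]`, which the Euler derivation `b·X₀∂₀ − a·X₁∂₁` (it kills `p`-th powers and
  `X₀ᵃX₁ᵇ`) reduces to `b·U(0)·V(0) = 0` — a contradiction (`no_radicial_identity`).

## Sources

W. Fulton, *Introduction to Toric Varieties*, Ann. of Math. Stud. 131 (1993), §2.1–2.2
(nonsingularity of affine toric varieties); H. Matsumura, *Commutative Ring Theory*, Thm. 20.3
(regular ⇒ factorial; the two-dimensional case is the tree's `QuadraticTransformsUFD.lean`).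
All statements in this file are [folklore].
-/

noncomputable section

namespace Literature.Barriers.ResolutionOfSingularities

namespace RadicialNormalization

open _root_.MvPolynomial IsLocalRing Literature.AlgebraicGeometry.Resolution

universe u

/-! ## The Euler derivation `b·X₀∂₀ − a·X₁∂₁` of `F[X₀, X₁]` and the impossible identity -/

section Poly

variable (F : Type u) [Field F] (a b : ℕ) (p : ℕ) [CharP F p]

/-- **The impossible identity.** In characteristic `p` with `b ≠ 0` in `F` there are no
`U, V ∈ F[X₀,X₁]` with `U(0) ≠ 0 ≠ V(0)`, `Q ≠ 0` and `Rᵢ` with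
`X₀ · V · Qᵖ = U · Σᵢ Rᵢᵖ (X₀ᵃX₁ᵇ)^{eᵢ}`. Proof: the Euler-type derivation
`D = b·X₀·∂/∂X₀ − a·X₁·∂/∂X₁` of `F[X₀, X₁]` kills `p`-th powers and `X₀ᵃX₁ᵇ` and has no
constant term; applied to the identity it gives `U·(bV + DV) = V·DU`, whose constant term reads
`b·U(0)·V(0) = 0`. [folklore] -/
theorem no_radicial_identity (hb : (b : F) ≠ 0) {U V Q : MvPolynomial (Fin 2) F}
    (hU : constantCoeff U ≠ 0) (hV : constantCoeff V ≠ 0) (hQ : Q ≠ 0)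
    {ι : Type*} (s : Finset ι) (R : ι → MvPolynomial (Fin 2) F) (e : ι → ℕ)
    (h : X 0 * V * Q ^ p = U * ∑ i ∈ s, R i ^ p * (X 0 ^ a * X 1 ^ b) ^ e i) : False := by
  -- the Euler derivation `D = b·X₀∂₀ − a·X₁∂₁`
  let D : Derivation F (MvPolynomial (Fin 2) F) (MvPolynomial (Fin 2) F) :=
    (C (b : F) * X 0 : MvPolynomial (Fin 2) F) •
        (pderiv 0 : Derivation F (MvPolynomial (Fin 2) F) (MvPolynomial (Fin 2) F)) -
      (C (a : F) * X 1 : MvPolynomial (Fin 2) F) •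
        (pderiv 1 : Derivation F (MvPolynomial (Fin 2) F) (MvPolynomial (Fin 2) F))
  have hD : ∀ f, D f = C (b : F) * X 0 * pderiv 0 f - C (a : F) * X 1 * pderiv 1 f := fun f => by
    simp only [D, Derivation.sub_apply, Derivation.smul_apply, smul_eq_mul]
  have hD0 : D (X 0) = C (b : F) * X 0 := by
    rw [hD, pderiv_X_self, pderiv_X_of_ne (by decide), mul_one, mul_zero, sub_zero]
  have hD1 : D (X 1) = -(C (a : F) * X 1) := by
    rw [hD, pderiv_X_self, pderiv_X_of_ne (by decide), mul_one, mul_zero, zero_sub]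
  have hDc : ∀ f, constantCoeff (D f) = 0 := fun f => by rw [hD]; simp
  have hDpow : ∀ f : MvPolynomial (Fin 2) F, D (f ^ p) = 0 := fun f => by
    rw [Derivation.leibniz_pow, smul_eq_mul, nsmul_eq_mul, CharP.cast_eq_zero, zero_mul]
  -- `D(X₀ᵃ) = ab·X₀ᵃ`, `D(X₁ᵇ) = −ab·X₁ᵇ`, so `D(X₀ᵃX₁ᵇ) = 0`
  have hDa : D (X 0 ^ a) = C ((a : F) * b) * X 0 ^ a := by
    rw [Derivation.leibniz_pow, hD0, smul_eq_mul, nsmul_eq_mul]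
    rcases Nat.eq_zero_or_pos a with h | h
    · rw [h]; simp
    · obtain ⟨k, hk⟩ : ∃ k, a = k + 1 := ⟨a - 1, by omega⟩
      rw [hk, Nat.add_sub_cancel, pow_succ, map_mul, map_natCast, map_natCast]
      ring
  have hDb : D (X 1 ^ b) = -(C ((a : F) * b) * X 1 ^ b) := by
    rw [Derivation.leibniz_pow, hD1, smul_eq_mul, nsmul_eq_mul]
    rcases Nat.eq_zero_or_pos b with h | h
    · rw [h]; simp
    · obtain ⟨k, hk⟩ : ∃ k, b = k + 1 := ⟨b - 1, by omega⟩
      rw [hk, Nat.add_sub_cancel, pow_succ, map_mul, map_natCast, map_natCast]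
      ring
  have hDab : ∀ n : ℕ, D ((X 0 ^ a * X 1 ^ b) ^ n) = 0 := fun n => by
    have h0 : D (X 0 ^ a * X 1 ^ b) = 0 := by
      rw [Derivation.leibniz, hDa, hDb, smul_eq_mul, smul_eq_mul]; ring
    rw [Derivation.leibniz_pow, h0, smul_zero, smul_zero]
  set W := ∑ i ∈ s, R i ^ p * (X 0 ^ a * X 1 ^ b) ^ e i with hW
  have hDW : D W = 0 := by
    rw [hW, map_sum]
    refine Finset.sum_eq_zero fun i _ => ?_
    rw [Derivation.leibniz, hDab, hDpow, smul_zero, smul_zero, add_zero]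
  -- apply `D` to both sides
  have h1 : D (X 0 * V * Q ^ p) = X 0 * (C (b : F) * V + D V) * Q ^ p := by
    rw [Derivation.leibniz, hDpow, smul_zero, zero_add, Derivation.leibniz, hD0, smul_eq_mul,
      smul_eq_mul, smul_eq_mul]
    ring
  have h2 : D (U * W) = D U * W := by
    rw [Derivation.leibniz, hDW, smul_zero, zero_add, smul_eq_mul, mul_comm]
  have h3 : U * (X 0 * (C (b : F) * V + D V) * Q ^ p) = D U * (X 0 * V * Q ^ p) := by
    rw [← h1, h, h2]; ring
  -- cancel `X₀ · Qᵖ`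
  have hX : (X 0 : MvPolynomial (Fin 2) F) * Q ^ p ≠ 0 := mul_ne_zero (X_ne_zero 0) (pow_ne_zero _ hQ)
  have h4 : (C (b : F) * V + D V) * U = D U * V := by
    have : X 0 * Q ^ p * ((C (b : F) * V + D V) * U) = X 0 * Q ^ p * (D U * V) := by
      calc X 0 * Q ^ p * ((C (b : F) * V + D V) * U)
          = U * (X 0 * (C (b : F) * V + D V) * Q ^ p) := by ring
        _ = D U * (X 0 * V * Q ^ p) := h3
        _ = X 0 * Q ^ p * (D U * V) := by ring
    exact mul_left_cancel₀ hX this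
  -- constant terms
  have h5 := congrArg constantCoeff h4
  simp only [map_mul, map_add, constantCoeff_C, hDc, add_zero, zero_mul] at h5
  exact mul_ne_zero (mul_ne_zero hb hV) hU h5

end Poly

/-! ## Rational functions in the coordinates: membership and common denominators -/

section Adjoin

variable {F : Type u} [Field F] {L : Type u} [Field L] [Algebra F L]

/-- Polynomial expressions in a family `c` lie in the subfield `F(c)`. [folklore] -/
theorem aeval_mem_adjoin {n : ℕ} (c : Fin n → L) (f : MvPolynomial (Fin n) F) :
    aeval c f ∈ IntermediateField.adjoin F (Set.range c) := by
  have h : aeval c f ∈ Algebra.adjoin F (Set.range c) := by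
    rw [Algebra.adjoin_range_eq_range_aeval]; exact ⟨f, rfl⟩
  exact IntermediateField.algebra_adjoin_le_adjoin F _ h

/-- **Common denominators in `F(c)`**: finitely many elements `wᵢ ∈ F(c)` can be written
`wᵢ = rᵢ(c)/s(c)` with a single denominator `s(c) ≠ 0`. [folklore] -/
theorem exists_common_denom {n : ℕ} (c : Fin n → L) {ι : Type*} (t : Finset ι) (w : ι → L)
    (hw : ∀ i ∈ t, w i ∈ IntermediateField.adjoin F (Set.range c)) :
    ∃ (s : MvPolynomial (Fin n) F) (r : ι → MvPolynomial (Fin n) F), aeval c s ≠ 0 ∧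
      ∀ i ∈ t, w i * aeval c s = aeval c (r i) := by
  classical
  induction t using Finset.induction_on with
  | empty => exact ⟨1, fun _ => 0, by simp, by simp⟩
  | @insert i t hi ih =>
    obtain ⟨s, r, hs, hr⟩ := ih (fun j hj => hw j (Finset.mem_insert_of_mem hj))
    obtain ⟨r', s', h'⟩ := (IntermediateField.mem_adjoin_range_iff F c (w i)).mp
      (hw i (Finset.mem_insert_self _ _))
    by_cases hs' : aeval c s' = 0
    · have hwi : w i = 0 := by rw [h', hs', div_zero]
      refine ⟨s, Function.update r i 0, hs, fun j hj => ?_⟩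
      rcases Finset.mem_insert.mp hj with rfl | hj
      · simp [hwi]
      · rw [Function.update_of_ne (ne_of_mem_of_not_mem hj hi)]; exact hr j hj
    · refine ⟨s * s', Function.update (fun j => r j * s') i (r' * s),
        by rw [map_mul]; exact mul_ne_zero hs hs', ?_⟩
      intro j hj
      rcases Finset.mem_insert.mp hj with rfl | hj
      · rw [Function.update_self, map_mul, map_mul, h', div_mul_eq_mul_div, div_eq_iff hs']
        ring
      · rw [Function.update_of_ne (ne_of_mem_of_not_mem hj hi), map_mul, map_mul, ← hr j hj]; ring

end Adjoin

/-! ## The rings `A = F[x,y]_{(x,y)} ⊆ K = F(x,y) ⊆ L ∋ z` and `B` = integral closure of `A` in `L` -/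

section Rings

variable {F : Type u} [Field F] {L : Type u} [Field L] [Algebra F L]
variable (p : ℕ) [hp : Fact p.Prime] [CharP F p]
variable {x y z : L} (hxy : AlgebraicIndependent F ![x, y]) {a b : ℕ}

/-- `x ∈ F[x,y]_{(x,y)}`. [folklore] -/
theorem x_mem_origin : x ∈ originLocalRing hxy := by
  simpa using mem_originLocalRing_self hxy 0

/-- `y ∈ F[x,y]_{(x,y)}`. [folklore] -/
theorem y_mem_origin : y ∈ originLocalRing hxy := by
  simpa using mem_originLocalRing_self hxy 1

/-- `x ∈ F(x,y)`. [folklore] -/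
theorem x_mem_adjoin : x ∈ IntermediateField.adjoin F (Set.range ![x, y]) :=
  IntermediateField.subset_adjoin _ _ ⟨0, rfl⟩

/-- `y ∈ F(x,y)`. [folklore] -/
theorem y_mem_adjoin : y ∈ IntermediateField.adjoin F (Set.range ![x, y]) :=
  IntermediateField.subset_adjoin _ _ ⟨1, rfl⟩

/-- **`F[x,y]_{(x,y)}` is integrally closed in `F(x,y)`** (it is a two-dimensional regular local
ring, hence factorial, hence integrally closed in its field of fractions `F(x,y)`): an element of
`F(x,y)` integral over `F[x,y]_{(x,y)}` lies in it. [folklore] -/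
theorem mem_origin_of_isIntegral_of_mem_adjoin {f : L}
    (hfK : f ∈ IntermediateField.adjoin F (Set.range ![x, y]))
    (hint : IsIntegral (originLocalRing hxy) f) : f ∈ originLocalRing hxy := by
  set A := originLocalRing hxy with hA
  haveI := isRegularLocalRing_originLocalRing hxy
  haveI : UniqueFactorizationMonoid A :=
    uniqueFactorizationMonoid_of_ringKrullDim_eq_two (by rw [hA, ringKrullDim_originLocalRing hxy]; rfl)
  obtain ⟨r, s, hf⟩ := (IntermediateField.mem_adjoin_range_iff F ![x, y] f).mp hfK
  by_cases hs : aeval ![x, y] s = 0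
  · rw [hf, hs, div_zero]; exact A.zero_mem
  set r' : A := ⟨aeval ![x, y] r, aeval_mem_originLocalRing hxy r⟩
  set s' : A := ⟨aeval ![x, y] s, aeval_mem_originLocalRing hxy s⟩
  have hs' : s' ≠ 0 := fun h => hs (congrArg Subtype.val h)
  have hunit : ∀ t : nonZeroDivisors A, IsUnit ((Algebra.ofId A L) t) := fun t => by
    rw [isUnit_iff_ne_zero]
    exact fun h0 => nonZeroDivisors.ne_zero t.2 (Subtype.ext h0)
  let φ : FractionRing A →ₐ[A] L := IsLocalization.liftAlgHom (M := nonZeroDivisors A) hunit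
  have hφinj : Function.Injective φ := φ.toRingHom.injective
  set q : FractionRing A := IsLocalization.mk' _ r' ⟨s', mem_nonZeroDivisors_of_ne_zero hs'⟩ with hq
  have hφq : φ q = f := by
    have h1 := congrArg φ (IsLocalization.mk'_spec (FractionRing A) r'
      ⟨s', mem_nonZeroDivisors_of_ne_zero hs'⟩)
    rw [map_mul, φ.commutes, φ.commutes] at h1
    change φ q * aeval ![x, y] s = aeval ![x, y] r at h1
    rw [hf, eq_div_iff hs]
    exact h1
  have hqint : IsIntegral A q := by
    rw [← isIntegral_algHom_iff φ hφinj, hφq]; exact hint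
  obtain ⟨a₀, ha₀⟩ := IsIntegrallyClosed.isIntegral_iff.mp hqint
  have : f = (a₀ : L) := by
    rw [← hφq, ← ha₀, φ.commutes]; rfl
  rw [this]; exact a₀.2

variable (hz : z ^ p = x ^ a * y ^ b)

include hz in
/-- **Frobenius on a `z`-expansion**: if `w·s(x,y) = Σᵢ rᵢ(x,y)·zⁱ` then
`wᵖ·s(x,y)ᵖ = Σᵢ rᵢ(x,y)ᵖ (xᵃyᵇ)ⁱ`, a polynomial expression in `x, y`. [folklore] -/
theorem pow_char_mul_eq {w : L} {t : Finset ℕ} {r : ℕ → MvPolynomial (Fin 2) F}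
    {s : MvPolynomial (Fin 2) F}
    (h : w * aeval ![x, y] s = ∑ i ∈ t, aeval ![x, y] (r i) * z ^ i) :
    w ^ p * aeval ![x, y] (s ^ p) =
      aeval ![x, y] (∑ i ∈ t, r i ^ p * (X 0 ^ a * X 1 ^ b) ^ i) := by
  haveI : CharP L p := charP_of_injective_algebraMap (algebraMap F L).injective p
  rw [map_pow, ← mul_pow, h, sum_pow_char, map_sum]
  refine Finset.sum_congr rfl fun i _ => ?_
  simp only [map_mul, map_pow, aeval_X, Matrix.cons_val_zero, Matrix.cons_val_one]
  rw [mul_pow, ← pow_mul, mul_comm i p, pow_mul, hz]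

include hz in
omit [CharP F p] in
/-- **`z`-expansions.** If `L = F(x,y)(z)` (and `zᵖ = xᵃyᵇ`, so that `z` is integral over
`F(x,y)`), every `w ∈ L` satisfies `w·s(x,y) = Σᵢ rᵢ(x,y)·zⁱ` for some polynomials `rᵢ, s` with
`s(x,y) ≠ 0` (expand in the power basis and clear denominators). [folklore] -/
theorem exists_expansion_of_adjoin_eq_top
    (htop : IntermediateField.adjoin (IntermediateField.adjoin F (Set.range ![x, y])) {z} = ⊤)
    (w : L) :
    ∃ (t : Finset ℕ) (r : ℕ → MvPolynomial (Fin 2) F) (s : MvPolynomial (Fin 2) F),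
      aeval ![x, y] s ≠ 0 ∧ w * aeval ![x, y] s = ∑ i ∈ t, aeval ![x, y] (r i) * z ^ i := by
  set K := IntermediateField.adjoin F (Set.range ![x, y]) with hK
  have hzK : z ^ p ∈ K := by
    rw [hz]; exact mul_mem (pow_mem x_mem_adjoin _) (pow_mem y_mem_adjoin _)
  have hint : IsIntegral K z := by
    refine IsIntegral.of_pow hp.out.pos ?_
    have : z ^ p = algebraMap K L ⟨z ^ p, hzK⟩ := rfl
    rw [this]; exact isIntegral_algebraMap
  have hw : w ∈ (IntermediateField.adjoin K {z}).toSubalgebra := by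
    rw [htop]; exact IntermediateField.mem_top
  rw [IntermediateField.adjoin_simple_toSubalgebra_of_isAlgebraic hint.isAlgebraic,
    Algebra.adjoin_singleton_eq_range_aeval] at hw
  obtain ⟨P, hP⟩ := hw
  change Polynomial.aeval z P = w at hP
  rw [Polynomial.aeval_eq_sum_range] at hP
  obtain ⟨s, r, hs, hr⟩ := exists_common_denom ![x, y] (Finset.range (P.natDegree + 1))
    (fun i => ((P.coeff i : K) : L)) (fun i _ => (P.coeff i).2)
  refine ⟨Finset.range (P.natDegree + 1), r, s, hs, ?_⟩
  rw [← hP, Finset.sum_mul]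
  refine Finset.sum_congr rfl fun i hi => ?_
  rw [Algebra.smul_def, mul_right_comm]
  change ((P.coeff i : K) : L) * aeval ![x, y] s * z ^ i = _
  rw [hr i hi]

include hz in
/-- `Lᵖ ⊆ F(x,y)` when `L = F(x,y)(z)`, `zᵖ ∈ F(x,y)`: `L/F(x,y)` is purely inseparable of
exponent one. [folklore] -/
theorem pow_char_mem_adjoin
    (htop : IntermediateField.adjoin (IntermediateField.adjoin F (Set.range ![x, y])) {z} = ⊤)
    (w : L) : w ^ p ∈ IntermediateField.adjoin F (Set.range ![x, y]) := by
  obtain ⟨t, r, s, hs, h⟩ := exists_expansion_of_adjoin_eq_top p hz htop w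
  have key := pow_char_mul_eq p hz h
  have hsp : aeval ![x, y] (s ^ p) ≠ 0 := by rw [map_pow]; exact pow_ne_zero _ hs
  rw [← eq_div_iff hsp] at key
  rw [key]
  exact div_mem (aeval_mem_adjoin _ _) (aeval_mem_adjoin _ _)

include hz in
/-- Elements of the integral closure `B` of `A = F[x,y]_{(x,y)}` in `L` have `p`-th powers in `A`.
[folklore] -/
theorem pow_char_mem_origin
    (htop : IntermediateField.adjoin (IntermediateField.adjoin F (Set.range ![x, y])) {z} = ⊤)
    {w : L} (hw : w ∈ integralClosure (originLocalRing hxy) L) : w ^ p ∈ originLocalRing hxy :=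
  mem_origin_of_isIntegral_of_mem_adjoin hxy (pow_char_mem_adjoin p hz htop w)
    ((mem_integralClosure_iff _ _).mp hw |>.pow p)

/-- `B ∩ F(x,y) = A`. [folklore] -/
theorem mem_origin_of_mem_integralClosure {w : L}
    (hw : w ∈ integralClosure (originLocalRing hxy) L)
    (hwK : w ∈ IntermediateField.adjoin F (Set.range ![x, y])) : w ∈ originLocalRing hxy :=
  mem_origin_of_isIntegral_of_mem_adjoin hxy hwK ((mem_integralClosure_iff _ _).mp hw)

/-- `A ⊆ B`. [folklore] -/
theorem origin_le_integralClosure {w : L} (hw : w ∈ originLocalRing hxy) :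
    w ∈ integralClosure (originLocalRing hxy) L :=
  (integralClosure (originLocalRing hxy) L).algebraMap_mem ⟨w, hw⟩

/-- **`dim B = 2`**: `B` is integral over the two-dimensional `A` (with `A → B` injective).
[folklore] -/
theorem ringKrullDim_integralClosure :
    ringKrullDim (integralClosure (originLocalRing hxy) L) = 2 := by
  have h := Literature.RingTheory.KrullDimension.ringKrullDim_eq_of_isIntegral
    (R := originLocalRing hxy) (S := integralClosure (originLocalRing hxy) L)
    (fun c d hcd => Subtype.ext (congrArg (fun t : integralClosure (originLocalRing hxy) L => (t : L)) hcd))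
  rw [← h, ringKrullDim_originLocalRing hxy]; rfl

include hz in
omit [CharP F p] in
/-- `z ∈ B` (`zᵖ = xᵃyᵇ ∈ A`). [folklore] -/
theorem z_mem_integralClosure : z ∈ integralClosure (originLocalRing hxy) L := by
  rw [mem_integralClosure_iff]
  refine IsIntegral.of_pow hp.out.pos ?_
  have hmem : z ^ p ∈ originLocalRing hxy := by
    rw [hz]; exact mul_mem (pow_mem (x_mem_origin hxy) _) (pow_mem (y_mem_origin hxy) _)
  exact isIntegral_algebraMap (R := originLocalRing hxy) (x := (⟨z ^ p, hmem⟩ : originLocalRing hxy))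

omit [CharP F p] in
/-- Exponent arithmetic: if `p ∤ a` there are `a', c` with `a·a' = p·c + 1`. [folklore] -/
theorem exists_mul_eq_mul_add_one (ha : ¬ p ∣ a) : ∃ a' c : ℕ, a * a' = p * c + 1 := by
  haveI : Fact (1 < p) := ⟨hp.out.one_lt⟩
  have hcop : Nat.Coprime a p := Nat.coprime_comm.mp ((Nat.Prime.coprime_iff_not_dvd hp.out).mpr ha)
  refine ⟨((a : ZMod p)⁻¹).val, a * ((a : ZMod p)⁻¹).val / p, ?_⟩
  have h1 : ((a * ((a : ZMod p)⁻¹).val : ℕ) : ZMod p) = 1 := by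
    rw [Nat.cast_mul, ZMod.natCast_zmod_val, ZMod.coe_mul_inv_eq_one a hcop]
  have h2 : (a * ((a : ZMod p)⁻¹).val) % p = 1 := by
    have := congrArg ZMod.val h1
    rwa [ZMod.val_natCast, ZMod.val_one] at this
  have h3 := Nat.div_add_mod (a * ((a : ZMod p)⁻¹).val) p
  omega

include hz in
/-- **The normalisation is not regular.** For algebraically independent `x, y` over a field `F`
of characteristic `p`, `z ∈ L` with `zᵖ = xᵃyᵇ`, `p ∤ a`, `p ∤ b`, and `L` spanned over
`F(x,y)` by `z` (so `L = F(x,y)(z)` is purely inseparable of degree `1` or `p` over `F(x,y)`):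
the integral closure `B` of `A = F[x,y]_{(x,y)}` in `L` is NOT a regular local ring.
Proof: were `B` regular (it is local of dimension two), it would be factorial; a common prime
factor of `x, y` in `B` would generate a prime lying over `𝔪_A`, i.e. the maximal ideal of `B`,
which is not principal — so `xᵃ, yᵇ` are relatively prime and `zᵖ = xᵃyᵇ` forces `xᵃ ~ dᵖ`,
whence `x = u·wᵖ` with `u ∈ A^×`, `w ∈ L`; expanding `w` in powers of `z` and clearing
denominators gives the identity excluded by `no_radicial_identity`. [folklore] -/
theorem not_isRegularLocalRing_integralClosure (ha : ¬ p ∣ a) (hb : ¬ p ∣ b)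
    (htop : IntermediateField.adjoin (IntermediateField.adjoin F (Set.range ![x, y])) {z} = ⊤) :
    ¬ IsRegularLocalRing (integralClosure (originLocalRing hxy) L) := by
  intro hreg
  set A := originLocalRing hxy with hA
  set B := integralClosure A L with hB
  haveI := isLocalRing_originLocalRing hxy
  have hdim : ringKrullDim B = 2 := ringKrullDim_integralClosure hxy
  haveI hufd : UniqueFactorizationMonoid B := uniqueFactorizationMonoid_of_ringKrullDim_eq_two hdim
  letI : GCDMonoid B := UniqueFactorizationMonoid.toGCDMonoid B
  -- the elements `x, y, z` of `B`
  have hxA : x ∈ A := x_mem_origin hxy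
  have hyA : y ∈ A := y_mem_origin hxy
  set xB : B := ⟨x, origin_le_integralClosure hxy hxA⟩ with hxB
  set yB : B := ⟨y, origin_le_integralClosure hxy hyA⟩ with hyB
  set zB : B := ⟨z, z_mem_integralClosure p hxy hz⟩ with hzB
  have hx0 : x ≠ 0 := by simpa using hxy.ne_zero 0
  have hxB0 : xB ≠ 0 := fun h => hx0 (congrArg Subtype.val h)
  -- no prime of `B` divides both `x` and `y`
  have hrel : IsRelPrime xB yB := by
    refine (UniqueFactorizationMonoid.isRelPrime_iff_no_prime_factors hxB0).mpr ?_
    intro d hdx hdy hd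
    set I : Ideal B := Ideal.span {d} with hI
    haveI hIp : I.IsPrime := (Ideal.span_singleton_prime hd.ne_zero).mpr hd
    have hcoord : ∀ i : Fin 2, algebraMap A B (originCoord hxy i) ∈ I := by
      refine Fin.forall_fin_two.mpr ⟨?_, ?_⟩
      · have : algebraMap A B (originCoord hxy 0) = xB := Subtype.ext rfl
        rw [this]; exact Ideal.mem_span_singleton.mpr hdx
      · have : algebraMap A B (originCoord hxy 1) = yB := Subtype.ext rfl
        rw [this]; exact Ideal.mem_span_singleton.mpr hdy
    have hle : maximalIdeal A ≤ I.comap (algebraMap A B) := by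
      rw [maximalIdeal_originLocalRing hxy, Ideal.span_le]
      rintro _ ⟨i, rfl⟩
      rw [SetLike.mem_coe, Ideal.mem_comap]
      exact hcoord i
    have hcomap : I.comap (algebraMap A B) = maximalIdeal A :=
      ((IsLocalRing.maximalIdeal.isMaximal A).eq_of_le (Ideal.IsPrime.ne_top inferInstance) hle).symm
    have hImax : I.IsMaximal :=
      Ideal.isMaximal_of_isIntegral_of_isMaximal_comap I (hcomap ▸ IsLocalRing.maximalIdeal.isMaximal A)
    have hIm : I = maximalIdeal B := (IsLocalRing.eq_maximalIdeal hImax)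
    have h1 : (maximalIdeal B).spanFinrank ≤ 1 := by
      rw [← hIm, hI, ← Set.ncard_singleton d]
      exact Submodule.spanFinrank_span_le_ncard_of_finite (Set.finite_singleton d)
    have h2 := hreg.spanFinrank_maximalIdeal
    rw [hdim] at h2
    have h3 : (maximalIdeal B).spanFinrank = 2 := by exact_mod_cast h2
    omega
  have hrel' : IsRelPrime (xB ^ a) (yB ^ b) := (hrel.pow_left).pow_right
  have hprod : xB ^ a * yB ^ b = zB ^ p := Subtype.ext (by simp [hxB, hyB, hzB, hz])
  obtain ⟨d, u, hdu⟩ := exists_associated_pow_of_mul_eq_pow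
    (gcd_isUnit_iff_isRelPrime.mpr hrel') hprod
  -- `x ^ a = d ^ p * u` in `L`
  set dL : L := (d : L) with hdL
  set uL : L := ((u : B) : L) with huL
  have hxa : x ^ a = dL ^ p * uL := by
    have := congrArg (fun t : B => (t : L)) hdu
    simpa [hxB] using this.symm
  -- exponent arithmetic `a a' = p c + 1`, and `x = uL^{a'} · (dL^{a'}/x^c)^p`
  obtain ⟨a', c, hac⟩ := exists_mul_eq_mul_add_one p ha
  set w : L := dL ^ a' / x ^ c with hw
  set uu : L := uL ^ a' with huu
  have key : x * (x ^ c) ^ p = uu * (dL ^ a') ^ p := by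
    calc x * (x ^ c) ^ p = x ^ (p * c + 1) := by rw [pow_succ, pow_mul', mul_comm]
      _ = x ^ (a * a') := by rw [hac]
      _ = (x ^ a) ^ a' := pow_mul x a a'
      _ = (dL ^ p * uL) ^ a' := by rw [hxa]
      _ = uu * (dL ^ a') ^ p := by
        rw [huu, mul_pow, ← pow_mul, ← pow_mul, mul_comm p a', mul_comm]
  have hxcp : (x ^ c) ^ p ≠ 0 := pow_ne_zero _ (pow_ne_zero _ hx0)
  have hxw : x = uu * w ^ p := by
    rw [hw, div_pow, ← mul_div_assoc, eq_div_iff hxcp, key]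
  -- `uu ∈ A` and `uu⁻¹ ∈ A`
  have huuB : uu ∈ B := by rw [huu]; exact pow_mem (u : B).2 a'
  have hu0 : uL ≠ 0 := fun h0 => (u.ne_zero (Subtype.ext h0))
  have hw0 : w ≠ 0 := by
    intro h0; apply hx0; rw [hxw, h0, zero_pow hp.out.ne_zero, mul_zero]
  have huuK : uu ∈ IntermediateField.adjoin F (Set.range ![x, y]) := by
    have : uu = x / w ^ p := by rw [hxw, mul_div_assoc, div_self (pow_ne_zero _ hw0), mul_one]
    rw [this]
    exact div_mem (x_mem_adjoin) (pow_char_mem_adjoin p hz htop w)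
  have huuA : uu ∈ A := mem_origin_of_mem_integralClosure hxy huuB huuK
  have huuinvB : uu⁻¹ ∈ B := by
    have hinv : (((u⁻¹ : Bˣ) : B) : L) = uL⁻¹ := by
      have h : uL * (((u⁻¹ : Bˣ) : B) : L) = 1 := by
        rw [huL, ← Subalgebra.coe_mul, Units.mul_inv, Subalgebra.coe_one]
      exact (eq_inv_of_mul_eq_one_right h)
    rw [huu, ← inv_pow, ← hinv]
    exact pow_mem ((u⁻¹ : Bˣ) : B).2 a'
  have huuinvA : uu⁻¹ ∈ A := mem_origin_of_mem_integralClosure hxy huuinvB (inv_mem huuK)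
  have huu0 : uu ≠ 0 := pow_ne_zero _ hu0
  -- write `uu = U(x,y)/V(x,y)` with `U(0) ≠ 0 ≠ V(0)`
  obtain ⟨U, V, hV, hUV⟩ := (mem_originLocalRing_iff hxy).mp huuA
  have hU : constantCoeff U ≠ 0 := by
    intro hU0
    have hmemUV : aeval ![x, y] U / aeval ![x, y] V ∈ A := hUV ▸ huuA
    have hmax := (div_mem_maximalIdeal_originLocalRing_iff hxy U V hV hmemUV).mpr hU0
    have heq : (⟨uu, huuA⟩ : A) = ⟨aeval ![x, y] U / aeval ![x, y] V, hmemUV⟩ := Subtype.ext hUV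
    have hunit : IsUnit (⟨uu, huuA⟩ : A) :=
      ⟨⟨⟨uu, huuA⟩, ⟨uu⁻¹, huuinvA⟩, Subtype.ext (mul_inv_cancel₀ huu0),
        Subtype.ext (inv_mul_cancel₀ huu0)⟩, rfl⟩
    rw [heq] at hunit
    exact (IsLocalRing.mem_maximalIdeal _).mp hmax hunit
  -- expand `w` in powers of `z` and clear denominators
  obtain ⟨t, r, s, hs, hws⟩ := exists_expansion_of_adjoin_eq_top p hz htop w
  have hwp := pow_char_mul_eq p hz hws
  have hVne : aeval ![x, y] V ≠ 0 := aeval_ne_zero_of_constantCoeff_ne_zero hxy hV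
  have huuV : uu * aeval ![x, y] V = aeval ![x, y] U := by rw [hUV, div_mul_cancel₀ _ hVne]
  have hxV : x * aeval ![x, y] V = aeval ![x, y] U * w ^ p := by
    calc x * aeval ![x, y] V = uu * w ^ p * aeval ![x, y] V := by rw [← hxw]
      _ = uu * aeval ![x, y] V * w ^ p := by ring
      _ = aeval ![x, y] U * w ^ p := by rw [huuV]
  have hid : aeval ![x, y] (X 0 * V * s ^ p) =
      aeval ![x, y] (U * ∑ i ∈ t, r i ^ p * (X 0 ^ a * X 1 ^ b) ^ i) := by
    calc aeval ![x, y] (X 0 * V * s ^ p) = x * aeval ![x, y] V * aeval ![x, y] (s ^ p) := by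
          rw [map_mul, map_mul, aeval_X, Matrix.cons_val_zero]
      _ = aeval ![x, y] U * (w ^ p * aeval ![x, y] (s ^ p)) := by rw [hxV]; ring
      _ = aeval ![x, y] (U * ∑ i ∈ t, r i ^ p * (X 0 ^ a * X 1 ^ b) ^ i) := by
          rw [hwp, ← map_mul]
  have hpoly := (algebraicIndependent_iff_injective_aeval.mp hxy) hid
  have hs0 : s ≠ 0 := fun h0 => hs (by rw [h0, map_zero])
  have hbF : (b : F) ≠ 0 := by rw [Ne, CharP.cast_eq_zero_iff F p]; exact hb
  exact no_radicial_identity F a b p hbF hU hV hs0 t r (fun i => i) hpoly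

/-! ## Localising at the centre of a valuation changes nothing -/

include hz in
/-- **`B` is already local at the centre**: if the valuation ring `V` of `L` dominates
`A = F[x,y]_{(x,y)}`, then `B_{𝔪_V ∩ B} = B` — a denominator `β ∈ B` of value `0` has
`βᵖ ∈ A` of value `0`, a unit of `A`, so `β⁻¹ = βᵖ⁻¹·(βᵖ)⁻¹ ∈ B`. [folklore] -/
theorem locAtCentre_integralClosure_eq
    (htop : IntermediateField.adjoin (IntermediateField.adjoin F (Set.range ![x, y])) {z} = ⊤)
    (V : ValuationSubring L)
    (hV : SubringDominates (originLocalRing hxy).toSubring V.toSubring) :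
    locAtCentre (integralClosure (originLocalRing hxy) L).toSubring V =
      (integralClosure (originLocalRing hxy) L).toSubring := by
  refine le_antisymm ?_ (le_locAtCentre _ V)
  rintro _ ⟨α, hα, β, hβ, hvβ, rfl⟩
  have hβ0 : β ≠ 0 := ne_zero_of_valuation_eq_one hvβ
  have hβp : β ^ p ∈ originLocalRing hxy := pow_char_mem_origin p hxy hz htop hβ
  have hβpinv : (β ^ p)⁻¹ ∈ originLocalRing hxy := by
    refine hV.2 _ hβp ?_
    change (β ^ p)⁻¹ ∈ V
    rw [← V.valuation_le_one_iff, map_inv₀, map_pow, hvβ, one_pow, inv_one]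
  have hβinv : β⁻¹ ∈ (integralClosure (originLocalRing hxy) L).toSubring := by
    have : β⁻¹ = β ^ (p - 1) * (β ^ p)⁻¹ := by
      have hp1 : β ^ p = β ^ (p - 1) * β := by rw [← pow_succ, Nat.sub_add_cancel hp.out.one_le]
      rw [hp1, mul_inv, ← mul_assoc, mul_inv_cancel₀ (pow_ne_zero _ hβ0), one_mul]
    rw [this]
    exact mul_mem (pow_mem hβ _) (origin_le_integralClosure hxy hβpinv)
  rw [div_eq_mul_inv]
  exact mul_mem hα hβinv

include hz in
/-- **The normalisation, localised at the centre of any valuation ring of `L` dominating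
`F[x,y]_{(x,y)}`, is not regular** (`zᵖ = xᵃyᵇ`, `p ∤ a`, `p ∤ b`, `L = F(x,y)(z)`). [folklore] -/
theorem not_isRegularLocalRing_locAtCentre (ha : ¬ p ∣ a) (hb : ¬ p ∣ b)
    (htop : IntermediateField.adjoin (IntermediateField.adjoin F (Set.range ![x, y])) {z} = ⊤)
    (V : ValuationSubring L) (hV : SubringDominates (originLocalRing hxy).toSubring V.toSubring) :
    ¬ IsRegularLocalRing (locAtCentre (integralClosure (originLocalRing hxy) L).toSubring V) := by
  intro hreg
  have e := RingEquiv.subringCongr (locAtCentre_integralClosure_eq p hxy hz htop V hV)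
  haveI := hreg
  haveI h1 : IsRegularLocalRing (integralClosure (originLocalRing hxy) L).toSubring :=
    IsRegularLocalRing.of_ringEquiv e
  -- `↥(B.toSubring) ≃+* ↥B` (the identity)
  let e' : (integralClosure (originLocalRing hxy) L).toSubring ≃+*
      integralClosure (originLocalRing hxy) L :=
    { toFun := fun w => ⟨w, w.2⟩
      invFun := fun w => ⟨w, w.2⟩
      left_inv := fun _ => rfl
      right_inv := fun _ => rfl
      map_mul' := fun _ _ => rfl
      map_add' := fun _ _ => rfl }
  exact not_isRegularLocalRing_integralClosure p hxy hz ha hb htop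
    (IsRegularLocalRing.of_ringEquiv e')

end Rings

end RadicialNormalization

end Literature.Barriers.ResolutionOfSingularities
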